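import Summits.CriticalPhenomena.PercolationContinuityZ3.Theorems.PercNearOneGluingNoHeavyLowerTailThreePartitionCubeGreedy

/-!
# Twisted three-partition positivity (★★) = (M⁺-3) on SIX letters: soundness of the checker, IV — **the batch test certifies the relative
# dual-cone membership (code level) of every pair in the batch, at every twist**

Support file (cell `prim-sahi`, seat `prim-sahi-typer` gen 34; `--supports stmt-CriticalPhenomena-4575`).  Pure proofs plus one bookkeeping definition
(`CodeRel`); no `sorry`, standard axioms.
* `CodeRel m c D` — `Σ_{y∈C} c y ≥ 0` for every up-closed set `C` of codes below `2^m` containing every code outside the mask `D`;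
* `codeRel_of_dom_crit` — domination (`Dom`) + the relative criterion `Σ_y (if y ∈ D then min(β y, 0) else β y) ≥ 0` give `CodeRel`;
* `failLanes_eq` — `failLanes` marks exactly the lanes whose biased criterion is `< 2^m · BIAS`;
* `scalarTest_sound` — the scalar fall-back (`relCrit` before or after the trusted `applyPlan`) certifies `CodeRel`;
* **`packedTest_sound`** — if a batch of masks passes `packedTest`, then for every twist `t < 2^m` and every lane `i`, the scalar profile of the pair
  `(fU i, fV i)` at `t` satisfies `CodeRel` with respect to `fD i`. [this work]
-/

namespace Summit.CriticalPhenomena.PercolationContinuityZ3.Theorems.ThreePartition.Cube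

open Finset SahiGridPattern.Pair43
open scoped BigOperators

/-! ### The relative dual cone, code level -/

/-- `CodeRel m c D`: nonnegative sums over the code up-sets containing the complement of the mask `D`. [this work] -/
def CodeRel (m : ℕ) (c : ℕ → ℤ) (D : ℕ) : Prop :=
  ∀ C : Finset ℕ, CodeUp m C → (∀ y < 2 ^ m, D.testBit y = false → y ∈ C) → 0 ≤ ∑ y ∈ C, c y

/-- The relative criterion of a balance. [this work] -/
def crit (m : ℕ) (β : ℕ → ℤ) (D : ℕ) : ℤ := ∑ y ∈ range (2 ^ m), (if D.testBit y then min (β y) 0 else β y)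

/-- **Domination + criterion ⇒ `CodeRel`.** [this work] -/
theorem codeRel_of_dom_crit {m : ℕ} {c β : ℕ → ℤ} {D : ℕ} (hdom : Dom m c β) (hcrit : 0 ≤ crit m β D) : CodeRel m c D := by
  intro C hC hD
  refine le_trans ?_ (hdom C hC)
  refine le_trans hcrit ?_
  unfold crit
  rw [← Finset.sum_sdiff hC.1]
  have h1 : ∑ y ∈ range (2 ^ m) \ C, (if D.testBit y then min (β y) 0 else β y) ≤ 0 := by
    refine Finset.sum_nonpos fun y hy => ?_
    rw [Finset.mem_sdiff, mem_range] at hy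
    have hDy : D.testBit y = true := by
      by_contra h
      exact hy.2 (hD y hy.1 (Bool.eq_false_iff.2 h))
    rw [if_pos hDy]; exact min_le_right _ _
  have h2 : ∑ y ∈ C, (if D.testBit y then min (β y) 0 else β y) ≤ ∑ y ∈ C, β y :=
    Finset.sum_le_sum fun y _ => by split_ifs <;> simp
  linarith

/-! ### `failLanes` reads off the criterion -/

/-- A `foldBelow` adding lane vectors is the lane vector of the sums. [this work] -/
theorem foldBelow_add_lanes (nb n : ℕ) (F : ℕ → ℕ) (φ : ℕ → ℕ → ℕ) (hF : ∀ y < n, F y = ofLanes nb (φ y)) :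
    foldBelow n (fun y acc => acc + F y) 0 = ofLanes nb (fun i => ∑ y ∈ range n, φ y i) := by
  induction n with
  | zero =>
    show 0 = _
    have : ofLanes nb (fun i => ∑ y ∈ range 0, φ y i) = ofLanes nb (fun _ => 0) := ofLanes_congr fun i _ => by simp
    rw [this]; unfold ofLanes; simp
  | succ n ih =>
    show foldBelow n (fun y acc => acc + F y) 0 + F n = _
    rw [ih (fun y hy => hF y (Nat.lt_succ_of_lt hy)), hF n (Nat.lt_succ_self n), ofLanes_add]
    exact ofLanes_congr fun i _ => by rw [Finset.sum_range_succ]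

/-- Expanding a `0/1` lane by `FMUL` and masking any lane below `2^GB` selects it. [this work] -/
theorem btFMUL_and' (M x : ℕ) {v : ℕ} (hv : v < 2 ^ GB) : (bt M x * FMUL) &&& v = bt M x * v := by
  unfold bt bit01
  cases M.testBit x
  · simp
  · simp only [if_true, Nat.one_mul]
    rw [Nat.land_comm, FMUL_eq, Nat.and_two_pow_sub_one_eq_mod]
    exact Nat.mod_eq_of_lt hv

/-- The complementary `0/1` lane, expanded and masked. [this work] -/
theorem cbtFMUL_and (M x : ℕ) {v : ℕ} (hv : v < 2 ^ GB) : ((1 - bt M x) * FMUL) &&& v = (1 - bt M x) * v := by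
  unfold bt bit01
  cases M.testBit x
  · simp only [Bool.false_eq_true, if_false, Nat.sub_zero, Nat.one_mul]
    rw [Nat.land_comm, FMUL_eq, Nat.and_two_pow_sub_one_eq_mod]
    exact Nat.mod_eq_of_lt hv
  · simp

/-- The natural-number criterion of lane `i`. [this work] -/
def critN (m : ℕ) (D : ℕ) (W : ℕ → ℕ) : ℕ := ∑ y ∈ range (2 ^ m), (if D.testBit y then min (W y) BIAS else W y)

/-- **`failLanes` lane by lane**: lane `i` is `1` iff its criterion is below `2^m · BIAS`. [this work] -/
theorem failLanes_eq {m nb : ℕ} (hm : 2 ^ m ≤ 64) {fD : ℕ → ℕ} (hD : ∀ i < nb, fD i < 2 ^ 64) {u : Array ℕ} {W : ℕ → ℕ → ℕ}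
    (hu : ∀ x < 2 ^ m, u.getD x 0 = ofLanes nb (W x)) (hWb : ∀ x < 2 ^ m, ∀ i < nb, W x i < 2 ^ 21) :
    failLanes (mkTabs m) (ones nb) (extractAll (mkTabs m) (ones nb) (ofLanes nb fD)) u =
      ofLanes nb (fun i => bit01 (decide (critN m (fD i) (fun y => W y i) < 2 ^ m * BIAS))) := by
  have hnp : (mkTabs m).np = 2 ^ m := mkTabs_np m
  have hGB : (2 : ℕ) ^ GB < 2 ^ LW := Nat.pow_lt_pow_right (by omega) (by decide)
  have h21 : (2 : ℕ) ^ 21 ≤ 2 ^ GB := pow21_le_GB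
  -- the summed term at `y`
  have hterm : ∀ y < 2 ^ m,
      (((extractAll (mkTabs m) (ones nb) (ofLanes nb fD)).getD y 0 * FMUL) &&& lmin (ones nb) (ones nb <<< GB) (u.getD y 0) (ones nb * BIAS))
        + (((ones nb - (extractAll (mkTabs m) (ones nb) (ofLanes nb fD)).getD y 0) * FMUL) &&& u.getD y 0) =
      ofLanes nb (fun i => if (fD i).testBit y then min (W y i) BIAS else W y i) := by
    intro y hy
    have hWy : ∀ i < nb, W y i < 2 ^ GB := fun i hi => (hWb y hy i hi).trans_le h21
    rw [extractAll_getD_U hm hD hy, hu y hy, biasV_eq, lmin_eq hWy (fun _ _ => BIAS_lt_GB), ofLanes_mul,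
      ofLanes_and (fun i _ => btFMUL_lt _ _) (fun i hi => ((Nat.min_le_left _ _).trans_lt (hWy i hi)).trans hGB), ones_eq,
      ofLanes_sub (fun i _ => bt_le _ _), ofLanes_mul,
      ofLanes_and (fun i _ => ?_) (fun i hi => (hWy i hi).trans hGB), ofLanes_add]
    · refine ofLanes_congr fun i hi => ?_
      rw [btFMUL_and' _ _ ((Nat.min_le_left _ _).trans_lt (hWy i hi)), cbtFMUL_and _ _ (hWy i hi)]
      unfold bt bit01
      cases (fD i).testBit y <;> simp
    · have h1 : (1 - bt (fD i) y) * FMUL ≤ 1 * FMUL := Nat.mul_le_mul_right _ (Nat.sub_le _ _)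
      have h2 : FMUL < 2 ^ GB := by rw [FMUL_eq]; exact Nat.sub_lt Nat.one_le_two_pow Nat.one_pos
      omega
  have hP := foldBelow_add_lanes nb (2 ^ m) _ (fun y i => if (fD i).testBit y then min (W y i) BIAS else W y i) hterm
  -- bounds on the criterion lanes
  have hcrit_lt : ∀ i < nb, critN m (fD i) (fun y => W y i) < 2 ^ 28 := by
    intro i hi
    unfold critN
    have hb : ∀ y ∈ range (2 ^ m), (if (fD i).testBit y then min (W y i) BIAS else W y i) ≤ 2 ^ 21 := fun y hy => by
      have := hWb y (mem_range.1 hy) i hi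
      split_ifs
      · exact (Nat.min_le_left _ _).trans this.le
      · exact this.le
    have := Finset.sum_le_card_nsmul (range (2 ^ m)) _ _ hb
    rw [Finset.card_range, smul_eq_mul] at this
    calc _ ≤ 2 ^ m * 2 ^ 21 := this
      _ ≤ 64 * 2 ^ 21 := Nat.mul_le_mul_right _ hm
      _ < 2 ^ 28 := by norm_num
  unfold failLanes
  simp only [hnp]
  have hassoc : (fun (y acc : ℕ) => acc +
        (((extractAll (mkTabs m) (ones nb) (ofLanes nb fD)).getD y 0 * FMUL) &&& lmin (ones nb) (ones nb <<< GB) (u.getD y 0) (ones nb * BIAS))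
        + (((ones nb - (extractAll (mkTabs m) (ones nb) (ofLanes nb fD)).getD y 0) * FMUL) &&& u.getD y 0)) =
      (fun (y acc : ℕ) => acc +
        ((((extractAll (mkTabs m) (ones nb) (ofLanes nb fD)).getD y 0 * FMUL) &&& lmin (ones nb) (ones nb <<< GB) (u.getD y 0) (ones nb * BIAS))
        + (((ones nb - (extractAll (mkTabs m) (ones nb) (ofLanes nb fD)).getD y 0) * FMUL) &&& u.getD y 0))) := by
    funext y acc; rw [Nat.add_assoc]
  have hg : ones nb <<< GB = ofLanes nb (fun _ => 1 * 2 ^ GB) := by rw [ones_eq, ofLanes_shiftLeft]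
  have hbm : ones nb * BIAS * 2 ^ m = ofLanes nb (fun _ => 1 * BIAS * 2 ^ m) := by rw [ones_eq, ofLanes_mul, ofLanes_mul]
  rw [hassoc, hP, hg, hbm, ofLanes_add, ofLanes_sub (fun i hi => ?_)]
  · have hdb : ∀ i < nb, critN m (fD i) (fun y => W y i) + 1 * 2 ^ GB - 1 * BIAS * 2 ^ m < 2 ^ LW := fun i hi => by
      have := hcrit_lt i hi
      have h2 : (2 : ℕ) ^ 28 ≤ 2 ^ GB := Nat.pow_le_pow_right (by omega) (by decide : 28 ≤ GB)
      have h3 : (2 : ℕ) ^ GB + 2 ^ GB ≤ 2 ^ LW := by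
        rw [← Nat.two_mul, ← Nat.pow_succ']; exact Nat.pow_le_pow_right (by omega) GB_lt_LW
      omega
    have e2 : (ofLanes nb fun i => (∑ y ∈ range (2 ^ m), (if (fD i).testBit y = true then min (W y i) BIAS else W y i)) + 1 * 2 ^ GB - 1 * BIAS * 2 ^ m) =
        ofLanes nb (fun i => critN m (fD i) (fun y => W y i) + 1 * 2 ^ GB - 1 * BIAS * 2 ^ m) := ofLanes_congr fun i _ => rfl
    rw [e2, extract_eq hdb (by decide : GB < LW), ones_eq, ofLanes_xor (fun _ _ => one_lt_two_pow_LW) (fun i _ => bit01_lt_LW _)]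
    refine ofLanes_congr fun i hi => ?_
    have e : critN m (fD i) (fun y => W y i) + 1 * 2 ^ GB - 1 * BIAS * 2 ^ m = critN m (fD i) (fun y => W y i) + 2 ^ GB - 2 ^ m * BIAS := by
      ring_nf
    have hmb : 2 ^ m * BIAS < 2 ^ GB :=
      lt_of_le_of_lt (show 2 ^ m * BIAS ≤ 2 ^ 18 by unfold BIAS; omega) (Nat.pow_lt_pow_right (by omega) (by decide : 18 < GB))
    rw [e, testBit_guard ((hcrit_lt i hi).trans_le (Nat.pow_le_pow_right (by omega) (by decide : 28 ≤ GB))) hmb, one_xor_bit01]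
    by_cases h : 2 ^ m * BIAS ≤ critN m (fD i) (fun y => W y i)
    · have h' : ¬ critN m (fD i) (fun y => W y i) < 2 ^ m * BIAS := Nat.not_lt_of_le h
      rw [decide_eq_true h, decide_eq_false h']; rfl
    · have h' : critN m (fD i) (fun y => W y i) < 2 ^ m * BIAS := Nat.lt_of_not_le h
      rw [decide_eq_false h, decide_eq_true h']; rfl
  · have : (1 : ℕ) * BIAS * 2 ^ m ≤ 2 ^ GB :=
      le_trans (show 1 * BIAS * 2 ^ m ≤ 2 ^ 18 by unfold BIAS; omega) (Nat.pow_le_pow_right (by omega) (by decide : 18 ≤ GB))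
    omega

/-! ### The scalar fall-back -/

/-- `foldBelow` adding integers is a sum. [this work] -/
theorem foldBelow_add_eq_sum_int (n : ℕ) (h : ℕ → ℤ) : foldBelow n (fun i acc => acc + h i) 0 = ∑ i ∈ range n, h i := by
  induction n with
  | zero => rfl
  | succ n ih => show foldBelow n (fun i acc => acc + h i) 0 + h n = _; rw [ih, Finset.sum_range_succ]

/-- `relCrit` computes the criterion of the array's entries. [this work] -/
theorem relCrit_eq (m : ℕ) (c : Array ℤ) (D : ℕ) :
    relCrit (mkTabs m) c D = decide (0 ≤ crit m (fun y => c.getD y 0) D) := by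
  unfold relCrit crit
  rw [mkTabs_np, foldBelow_add_eq_sum_int]

/-- **One checked transfer keeps domination** (and the size). [this work] -/
theorem dom_applyStep {m : ℕ} {p : ℕ → ℤ} {c : Array ℤ} (hsz : c.size = 2 ^ m) (hdom : Dom m p (fun x => c.getD x 0)) (w y a : ℕ) :
    (applyStep (mkTabs m) c w y a).size = 2 ^ m ∧ Dom m p (fun x => (applyStep (mkTabs m) c w y a).getD x 0) := by
  unfold applyStep
  rw [mkTabs_np]
  split_ifs with h
  · simp only [Bool.and_eq_true, decide_eq_true_eq] at h
    obtain ⟨⟨hsub, hw⟩, hy⟩ := h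
    have hw' : w < c.size := hsz ▸ hw
    have hy' : y < (c.setIfInBounds w (c.getD w 0 - a)).size := by simp [hsz, hy]
    refine ⟨by simp [hsz], ?_⟩
    have e : (fun x => ((c.setIfInBounds w (c.getD w 0 - a)).setIfInBounds y ((c.setIfInBounds w (c.getD w 0 - a)).getD y 0 + a)).getD x 0) =
        fun x => c.getD x 0 - (if x = w then (a : ℤ) else 0) + (if x = y then (a : ℤ) else 0) := by
      funext x
      rw [getD_setIfInBounds _ hy', getD_setIfInBounds _ hw', getD_setIfInBounds _ hw']
      by_cases hxy : y = x
      · subst hxy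
        by_cases hxw : w = y
        · subst hxw; simp
        · simp [hxw, Ne.symm hxw]
      · by_cases hxw : w = x
        · subst hxw; simp [hxy, Ne.symm hxy]
        · simp [hxy, hxw, Ne.symm hxy, Ne.symm hxw]
    rw [e]
    exact dom_transfer hdom hw hsub (Int.natCast_nonneg a)
  · exact ⟨hsz, hdom⟩

/-- A checked plan keeps domination. [this work] -/
theorem dom_applyPlan {m : ℕ} {p : ℕ → ℤ} : ∀ (plan : List (ℕ × ℕ × ℕ)) {c : Array ℤ}, c.size = 2 ^ m → Dom m p (fun x => c.getD x 0) →
    Dom m p (fun x => (applyPlan (mkTabs m) c plan).getD x 0)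
  | [], c, _, h => by unfold applyPlan; exact h
  | (w, y, a) :: rest, c, hsz, h => by
    unfold applyPlan
    have h1 := dom_applyStep hsz h w y a
    exact dom_applyPlan rest h1.1 h1.2

/-- **Soundness of the scalar fall-back test.** [this work] -/
theorem scalarTest_sound {m : ℕ} {U V D t : ℕ} (h : scalarTest (mkTabs m) U V D t = true) : CodeRel m (prof m U V t) D := by
  have hsz : (profileArr (mkTabs m) U V t).size = 2 ^ m := by unfold profileArr; simp [mkTabs_np]
  unfold scalarTest at h
  simp only [Bool.or_eq_true] at h
  rcases h with h | h
  · rw [relCrit_eq] at h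
    exact codeRel_of_dom_crit (dom_refl m (prof m U V t)) (of_decide_eq_true h)
  · rw [relCrit_eq] at h
    exact codeRel_of_dom_crit (dom_applyPlan _ hsz (dom_refl m (prof m U V t))) (of_decide_eq_true h)

/-! ### Soundness of the batch test -/

/-- **Soundness of `packedTestAt`.** [this work] -/
theorem packedTestAt_sound {m : ℕ} (hm : 2 ^ m ≤ 64) {b : Batch} {fU fV fD : ℕ → ℕ} (hpu : b.pu = ofLanes b.n fU) (hpv : b.pv = ofLanes b.n fV)
    (hpd : b.pd = ofLanes b.n fD) (hU : ∀ i < b.n, fU i < 2 ^ 64) (hV : ∀ i < b.n, fV i < 2 ^ 64) (hD : ∀ i < b.n, fD i < 2 ^ 64)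
    {t : ℕ} (ht : t < 2 ^ m)
    (h : packedTestAt (mkTabs m) b (ones b.n) (extractAll (mkTabs m) (ones b.n) b.pu) (extractAll (mkTabs m) (ones b.n) b.pv)
      (Array.ofFn fun c : Fin (mkTabs m).np =>
        (extractAll (mkTabs m) (ones b.n) b.pu).getD c 0 &&& (extractAll (mkTabs m) (ones b.n) b.pv).getD c 0)
      (extractAll (mkTabs m) (ones b.n) b.pd) t = true) :
    ∀ i < b.n, CodeRel m (prof m (fU i) (fV i) t) (fD i) := by
  intro i hi
  have hU' : ∀ i < b.n, fU i < 2 ^ LW := fun i hi => (hU i hi).trans_le pow64_le_LW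
  have hV' : ∀ i < b.n, fV i < 2 ^ LW := fun i hi => (hV i hi).trans_le pow64_le_LW
  have hD' : ∀ i < b.n, fD i < 2 ^ LW := fun i hi => (hD i hi).trans_le pow64_le_LW
  unfold packedTestAt at h
  simp only [hpu, hpv, hpd, Bool.or_eq_true, beq_iff_eq] at h
  -- the invariant through the greedy
  have hG := gstate_packedGreedy hm (gstate_init hm hU hV ht)
  obtain ⟨hsize, W, hu, hl⟩ := hG
  have hWb : ∀ x < 2 ^ m, ∀ i < b.n, W x i < 2 ^ 21 := fun x hx i hi => by
    obtain ⟨β, hW, hlow, htot, _⟩ := hl i hi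
    have h1 := lane_small' hm hlow htot hx
    unfold TOTC LOWC at h1; unfold BIAS at hW
    have : (W x i : ℤ) < 2 ^ 21 := by rw [hW x hx]; norm_num at h1 ⊢; linarith
    exact_mod_cast this
  have hfl := failLanes_eq hm hD hu hWb
  have key : (failLanes (mkTabs m) (ones b.n) (extractAll (mkTabs m) (ones b.n) (ofLanes b.n fD))
        (packedGreedy (mkTabs m) (ones b.n) (packedProfile (mkTabs m) (ones b.n) (extractAll (mkTabs m) (ones b.n) (ofLanes b.n fU))
          (extractAll (mkTabs m) (ones b.n) (ofLanes b.n fV))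
          (Array.ofFn fun c : Fin (mkTabs m).np =>
            (extractAll (mkTabs m) (ones b.n) (ofLanes b.n fU)).getD c 0 &&& (extractAll (mkTabs m) (ones b.n) (ofLanes b.n fV)).getD c 0) t))).testBit
      (LW * i) = decide (critN m (fD i) (fun y => W y i) < 2 ^ m * BIAS) := by
    rw [hfl, show LW * i = LW * i + 0 from rfl, testBit_ofLanes (fun i _ => bit01_lt_LW _) i 0 LW_pos, testBit_bit01]
    simp only [hi, decide_true, Bool.true_and, Bool.and_true]
  obtain ⟨β, hW, hlow, htot, hdom⟩ := hl i hi
  have hcase : decide (critN m (fD i) (fun y => W y i) < 2 ^ m * BIAS) = false ∨ scalarTest (mkTabs m) (fU i) (fV i) (fD i) t = true := by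
    rcases h with h1 | h2
    · left
      have e := key
      rw [h1, Nat.zero_testBit] at e
      exact e.symm
    · rw [allBelow_iff] at h2
      have h3 := h2 i hi
      rw [Bool.or_eq_true, Bool.not_eq_true', key, laneOf_ofLanes hU' hi, laneOf_ofLanes hV' hi, laneOf_ofLanes hD' hi] at h3
      exact h3
  rcases hcase with hall | hsc
  · -- the criterion holds: translate to the integer criterion of `β`
    have hge : 2 ^ m * BIAS ≤ critN m (fD i) (fun y => W y i) := Nat.le_of_not_lt (of_decide_eq_false hall)
    refine codeRel_of_dom_crit hdom ?_
    have e : (critN m (fD i) (fun y => W y i) : ℤ) = 2 ^ m * BIAS + crit m β (fD i) := by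
      unfold critN crit
      push_cast
      rw [show ((2 : ℤ) ^ m) * BIAS = ∑ y ∈ range (2 ^ m), (BIAS : ℤ) by rw [Finset.sum_const, Finset.card_range]; ring,
        ← Finset.sum_add_distrib]
      refine Finset.sum_congr rfl fun y hy => ?_
      have hWy := hW y (mem_range.1 hy)
      split_ifs
      · have e3 : min (((BIAS : ℕ) : ℤ) + β y) ((BIAS : ℕ) : ℤ) = ((BIAS : ℕ) : ℤ) + min (β y) 0 := by
          have := min_add_add_left ((BIAS : ℕ) : ℤ) (β y) 0; rwa [add_zero] at this
        rw [hWy, e3]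
      · rw [hWy]
    have : ((2 ^ m * BIAS : ℕ) : ℤ) ≤ (critN m (fD i) (fun y => W y i) : ℤ) := by exact_mod_cast hge
    push_cast at this
    linarith
  · exact scalarTest_sound hsc

/-- **Soundness of `packedTest`**: every pair of a passing batch satisfies `CodeRel` at every twist. [this work] -/
theorem packedTest_sound {m : ℕ} (hm : 2 ^ m ≤ 64) {b : Batch} {fU fV fD : ℕ → ℕ} (hpu : b.pu = ofLanes b.n fU) (hpv : b.pv = ofLanes b.n fV)
    (hpd : b.pd = ofLanes b.n fD) (hU : ∀ i < b.n, fU i < 2 ^ 64) (hV : ∀ i < b.n, fV i < 2 ^ 64) (hD : ∀ i < b.n, fD i < 2 ^ 64)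
    (h : packedTest (mkTabs m) b = true) : ∀ t < 2 ^ m, ∀ i < b.n, CodeRel m (prof m (fU i) (fV i) t) (fD i) := by
  intro t ht i hi
  unfold packedTest at h
  simp only [Bool.or_eq_true, beq_iff_eq] at h
  rcases h with h0 | h
  · omega
  · rw [allBelow_iff] at h
    exact packedTestAt_sound hm hpu hpv hpd hU hV hD ht (h t (by rw [mkTabs_np]; exact ht)) i hi

end Summit.CriticalPhenomena.PercolationContinuityZ3.Theorems.ThreePartition.Cube
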